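import Mathlib
import Summits.KontsevichZagierPeriods.Zeta5Search.RecordCellDAtlasNotMin
import Summits.KontsevichZagierPeriods.Zeta5Search.RecordCellDDigits
import Summits.KontsevichZagierPeriods.Zeta5Search.RecordCellAProof
import HarnessLib

/-!
# ζ(5) search — RECORD CELL D is a THEOREM: `v_p(Cas₇(b(n))) ≥ −12` for `7n < p < 7.5n` on the Brown–Zudilin record ray

Cell `pub-zeta5` (HONEST FRAMING: systematic search; no irrationality claim unless certified), P1 prover seat
generation 6.  Census g11 (`STRUCTURE §15.4`, typed as `CellAtlas.RecordCellD`, weight 0.500 nats/step): for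
`b(n) = bRec n = n·(41;17,…,11)` and a prime `14n < 2p < 15n` the tree proves `v_p(Cas₇(b(n))) ≥ −13` (THEOREM LB, `casLB = −13`)
while the truth is `−12` (15/15 instances).  This file proves **`v_p(Cas₇(b(n))) ≥ −12` for all `n ≥ 2`** (`recordCellD`), gen-2 g9's
THEOREM D-CELL (REPORT-gen2-g9 §3/§8.3: an LB♯♯ instance two levels deeper than cell A), by the `W`-row route of `RecordCellAProof`:

* `Cas₇ = W(b⁺)V(b) − W(b)V(b⁺)` regrouped by residue classes; outside the minimal classes `Min = MinT1 ∪ MinS ∪ MinT2`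
  (`RecordCellDAtlas{,NotMin}`: `E_x ≥ −7`) one has `‖W_x‖ ≤ p⁴` (Theorems A/A′) and `‖V_x‖ ≤ p⁷` (`ClassNuBound`), for `b` and `b⁺`;
* on `Min` the normalised digits are TYPE CONSTANTS times the class unit (`LevelClassDigits`, from P1 g5's `wDigit`/`vDigit`
  and G1/G2): `p⁵W_x ≡ −ĝ_x ŵ(T)`, `p⁸V_x ≡ ĝ_x v̂(T)`, and the conjugate class carries `−ĝ_x` — so the palindromic `MinS`-pairs
  CANCEL and every `MinT1/MinT2`-pair contributes `ĝ_x·(−α, β)` with the SAME two constants `α = ŵ(T₁) − ŵ(T₂)`,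
  `β = v̂(T₁) − v̂(T₂)` (never evaluated): `A := p⁵W_M ≡ −αG`, `B := p⁸V_M ≡ βG`, `G = Σ_{MinT1} ĝ_x`, for `b` and for `b⁺`;
* `A′B − AB′ = (A′+αG′)B − αG′(B−βG) − (A+αG)B′ + αG(B′−βG′) ≡ 0 (mod p)` and
  `p¹³·Cas₇ = (A′B − AB′) + p·(…) + p²·(…)`, whence `‖Cas₇‖_p ≤ p¹²`.
`recordCellD_holds : CellAtlas.RecordCellD` discharges census g11's statement BY NAME.  Valuations of rational numbers; nothing
about irrationality.  Exact cross-check of every intermediate congruence at the seven record primes with `n ≤ 10`: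
`code/p1/g6/cellD_check.py` (independent partial-fraction kernel).
-/

noncomputable section

open Finset

namespace Summit.KontsevichZagierPeriods.Zeta5Search.CellD

open Summit.KontsevichZagierPeriods.Zeta5Search.DualSeries (InBox)
open Summit.KontsevichZagierPeriods.Zeta5Search.WedgeDictionary (pfData coeffW coeffV)
open Summit.KontsevichZagierPeriods.Zeta5Search.CasoratianValuation (InPolytope shift casoratian)
open Summit.KontsevichZagierPeriods.Zeta5Search.ClusterValuation
open Summit.KontsevichZagierPeriods.Zeta5Search.PadicSeries
open Summit.KontsevichZagierPeriods.Zeta5Search.BigPrime (shift_zero padicNorm_mul_le_one)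
open Summit.KontsevichZagierPeriods.Zeta5Search.CellA
open Summit.KontsevichZagierPeriods.Zeta5Search.LevelClass

variable {p : ℕ} [hp : Fact p.Prime]

/-! ### §1 Per-class bounds outside the minimal classes -/

/-- **`‖W_x‖ ≤ p^{−(m+3)}`** when the class has no pole, one pole (Theorem A′), or class exponent `≥ m` (Theorem A), `m ≤ −3`. -/
theorem padicNorm_classW_le (b : ℕ → ℤ) (hb : InPolytope b) (hp5 : 5 ≤ p) (hwin : (b 0 + 2 : ℤ) < (p : ℤ) ^ 2)
    {x : ℕ} {m : ℤ} (hm : m ≤ -3) (hE : 2 ≤ classPoleCount b p x → m ≤ classExp b p x) :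
    padicNorm p (classW b p x) ≤ (p : ℚ) ^ (-(m + 3)) := by
  have h1p : (1 : ℚ) ≤ (p : ℚ) ^ (-(m + 3)) := one_le_zpow₀ one_le_p (by omega)
  unfold classW
  refine padicNorm.sum_le' (fun q hq => ?_) (zpow_p_nonneg _)
  have hqn : q ≤ (b 0).toNat := ((mem_classSet_iff b x q).1 hq).1
  by_cases hreg : 0 ≤ netExp b q
  · rw [pfData_eq_zero_of_netExp_nonneg b hb hqn hreg (by norm_num : 2 < 6), padicNorm.zero]; exact zpow_p_nonneg _
  · push Not at hreg
    have hcount : classPoleCount b p q = classPoleCount b p x := by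
      unfold classPoleCount; rw [classSet_eq_of_mem hq]
    have hpos : 1 ≤ classPoleCount b p x := by
      unfold classPoleCount
      exact card_pos.2 ⟨q, mem_filter.2 ⟨hq, hreg⟩⟩
    by_cases hone : classPoleCount b p x = 1
    · refine le_trans ?_ h1p
      have h1 := padicNorm_le_of_val (p := p) (x := pfData b 2 q) (m := 0) (fun hne => ?_)
      · simpa using h1
      exact isolatedPoleIntegral_holds b p q 2 hb hp.out (by omega) hwin hqn (by norm_num) hne (by rw [hcount, hone])
    · refine padicNorm_le_of_val fun hne => ?_
      have hA := clusterBound_holds b p q 2 hb hp.out (by omega) hwin hqn (by norm_num) hne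
      rw [classExp_eq_of_mem hq] at hA
      have := hE (by omega)
      push_cast at hA
      linarith

/-- **`‖V_x‖ ≤ p^{−v}`** for a class with `ν_x ≥ v` (or without poles). -/
theorem padicNorm_classV_le_of (b : ℕ → ℤ) (hb : InPolytope b) (hp5 : 5 ≤ p) (hwin : (b 0 + 2 : ℤ) < (p : ℤ) ^ 2)
    {x : ℕ} (hx : x < p) {v : ℤ} (hν : 1 ≤ classPoleCount b p x → v ≤ classNu b p x) :
    padicNorm p (classV b p x) ≤ (p : ℚ) ^ (-v) := by
  rcases Nat.eq_zero_or_pos (classPoleCount b p x) with h0 | hpos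
  · rw [classV_eq_zero_of_noPole b hb h0, padicNorm.zero]; exact zpow_p_nonneg _
  · exact (padicNorm_classV_le b hb hp5 hwin hx hpos).trans (zpow_le_zpow_right₀ one_le_p (by linarith [hν hpos]))

/-! ### §2 The two halves of `W` and `V`, the unit sum -/

/-- The minimal part of `W`. -/
def WM (n p : ℕ) (b : ℕ → ℤ) : ℚ := ∑ x ∈ MinAll n p, classW b p x
/-- The rest of `W`. -/
def WR (n p : ℕ) (b : ℕ → ℤ) : ℚ := ∑ x ∈ range p \ MinAll n p, classW b p x
/-- The minimal part of `V`. -/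
def VM (n p : ℕ) (b : ℕ → ℤ) : ℚ := ∑ x ∈ MinAll n p, classV b p x
/-- The rest of `V`. -/
def VR (n p : ℕ) (b : ℕ → ℤ) : ℚ := ∑ x ∈ range p \ MinAll n p, classV b p x
/-- The unit sum `G = Σ_{x ∈ MinT1} ĝ_x`. -/
def GS (n p : ℕ) (b : ℕ → ℤ) : ℚ := ∑ x ∈ MinT1 n p, gHat b p x

omit hp in
/-- `W = W_M + W_R`. -/
theorem coeffW_split (n : ℕ) {p : ℕ} (hp0 : 0 < p) (b : ℕ → ℤ) : coeffW b = WM n p b + WR n p b := by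
  rw [coeffW_eq_sum_classW b hp0, WM, WR, ← sum_union disjoint_sdiff, union_sdiff_of_subset (minAll_subset n p)]

omit hp in
/-- `V = V_M + V_R`. -/
theorem coeffV_split (n : ℕ) {p : ℕ} (hp0 : 0 < p) (b : ℕ → ℤ) : coeffV b = VM n p b + VR n p b := by
  rw [coeffV_eq_sum_classV b hp0, VM, VR, ← sum_union disjoint_sdiff, union_sdiff_of_subset (minAll_subset n p)]

/-! ### §3 The minimal block: sums over `MinAll` and THE TWO CONGRUENCES (class data as in `RecordCellDDigits`) -/

section MinBlock

variable {n : ℕ} (hp14 : 14 * n < 2 * p) (hp15 : 2 * p < 15 * n) (hp5 : 5 ≤ p)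
  (b : ℕ → ℤ) (hb : InPolytope b) (hwin : (b 0 + 2 : ℤ) < (p : ℤ) ^ 2) (hN : (b 0).toNat = 41 * n)
  (hcen : ∀ x, x < p → 2 * x + 4 * p ≠ 41 * n → 2 * x + 5 * p ≠ 41 * n → ¬ CentreIn b p x)
  (hT1 : ∀ x ∈ MinT1 n p, netExp b x = 1 ∧ netExp b (x + p) = -1 ∧ netExp b (x + 2 * p) = -6 ∧
      netExp b (x + 3 * p) = -3 ∧ netExp b (x + 4 * p) = 1)
  (hS : ∀ x ∈ MinS n p, netExp b x = 1 ∧ netExp b (x + p) = -2 ∧ netExp b (x + 2 * p) = -6 ∧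
      netExp b (x + 3 * p) = -2 ∧ netExp b (x + 4 * p) = 1)
  (hT2 : ∀ x ∈ MinT2 n p, netExp b x = 1 ∧ netExp b (x + p) = -3 ∧ netExp b (x + 2 * p) = -6 ∧
      netExp b (x + 3 * p) = -1 ∧ netExp b (x + 4 * p) = 1)

include hp14 in
omit hp in
/-- A sum over `MinT2` is the sum over `MinT1` of the conjugates. -/
theorem sum_minT2_eq (f : ℕ → ℚ) : ∑ x ∈ MinT2 n p, f x = ∑ x ∈ MinT1 n p, f (41 * n - (x + 4 * p)) := by
  refine (sum_nbij' (fun x => 41 * n - (x + 4 * p)) (fun x => 41 * n - (x + 4 * p)) (fun x hx => conj_mem_minT2 hx)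
    (fun x hx => conj_mem_minT1 hx) (fun x hx => ?_) (fun x hx => ?_) (fun x hx => rfl)).symm
  · have := mem_minT1.1 hx; omega
  · have := mem_minT2.1 hx; omega

include hp14 in
omit hp in
/-- A sum over `MinS` equals the sum of the conjugates. -/
theorem sum_minS_conj (f : ℕ → ℚ) : ∑ x ∈ MinS n p, f (41 * n - (x + 4 * p)) = ∑ x ∈ MinS n p, f x :=
  sum_nbij' (fun x => 41 * n - (x + 4 * p)) (fun x => 41 * n - (x + 4 * p)) (fun x hx => conj_mem_minS hp14 hx)
    (fun x hx => conj_mem_minS hp14 hx) (fun x hx => by have := mem_minS.1 hx; omega)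
    (fun x hx => by have := mem_minS.1 hx; omega) (fun x hx => rfl)

include hp14 in
omit hp in
/-- Splitting a sum over `MinAll` into conjugate pairs of `MinT1 ∪ MinT2` and the classes of `MinS`. -/
theorem sum_minAll (f : ℕ → ℚ) :
    ∑ x ∈ MinAll n p, f x = ∑ x ∈ MinT1 n p, (f x + f (41 * n - (x + 4 * p))) + ∑ x ∈ MinS n p, f x := by
  rw [MinAll, sum_union (disjoint_minT1S_minT2 n p), sum_union (disjoint_minT1_minS n p), sum_minT2_eq hp14,
    sum_add_distrib]
  ring

/-- `‖2y‖ ≤ p⁻¹ ⇒ ‖y‖ ≤ p⁻¹` (`p` odd). -/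
theorem small_of_two_mul (hp5 : 5 ≤ p) {y : ℚ} (h : padicNorm p (2 * y) ≤ (p : ℚ) ^ (-(1 : ℤ))) :
    padicNorm p y ≤ (p : ℚ) ^ (-(1 : ℤ)) := by
  have htwo : padicNorm p (2 : ℚ) = 1 := by
    have hp2 : p ≠ 2 := by omega
    have := (padicNorm.nat_eq_one_iff (p := p) 2).2 (by
      intro h
      exact hp2 ((Nat.prime_dvd_prime_iff_eq hp.out Nat.prime_two).1 h))
    exact_mod_cast this
  rw [padicNorm.mul, htwo, one_mul] at h
  exact h

include hp14 hp15 hp5 hb hwin hN hcen hT1 hS hT2 in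
/-- **The minimal block**: `‖p⁵W_M‖ ≤ 1`, `‖p⁸V_M‖ ≤ 1`, `‖α·G‖ ≤ 1`, `‖G‖ ≤ 1`, and THE TWO CONGRUENCES
`p⁵W_M + α·G ≡ 0`, `p⁸V_M − β·G ≡ 0 (mod p)`. -/
theorem minBlock :
    padicNorm p ((p : ℚ) ^ 5 * WM n p b) ≤ 1 ∧ padicNorm p ((p : ℚ) ^ 8 * VM n p b) ≤ 1 ∧
    padicNorm p (alphaD * GS n p b) ≤ 1 ∧ padicNorm p (GS n p b) ≤ 1 ∧
    padicNorm p ((p : ℚ) ^ 5 * WM n p b + alphaD * GS n p b) ≤ (p : ℚ) ^ (-(1 : ℤ)) ∧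
    padicNorm p ((p : ℚ) ^ 8 * VM n p b - betaD * GS n p b) ≤ (p : ℚ) ^ (-(1 : ℤ)) := by
  have PT := fun x (hx : x ∈ MinT1 n p) => packT1 hp14 hp15 hp5 b hb hwin hN hcen hT1 hT2 hx
  have PS := fun x (hx : x ∈ MinS n p) => packS hp14 hp15 hp5 b hb hwin hN hcen hS hx
  refine ⟨?_, ?_, ?_, ?_, ?_, ?_⟩
  · rw [WM, mul_sum, sum_minAll hp14]
    refine nI_add (padicNorm.sum_le' (fun x hx => ?_) zero_le_one) (padicNorm.sum_le' (fun x hx => ?_) zero_le_one)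
    · obtain ⟨-, -, h1, -, h3, -, -, -⟩ := PT x hx
      exact nI_add h1 h3
    · exact (PS x hx).2.2.1
  · rw [VM, mul_sum, sum_minAll hp14]
    refine nI_add (padicNorm.sum_le' (fun x hx => ?_) zero_le_one) (padicNorm.sum_le' (fun x hx => ?_) zero_le_one)
    · obtain ⟨-, -, -, h2, -, h4, -, -⟩ := PT x hx
      exact nI_add h2 h4
    · exact (PS x hx).2.2.2
  · rw [GS, mul_sum]
    exact padicNorm.sum_le' (fun x hx => padicNorm_mul_le_one (PT x hx).2.2.2.2.2.2.1 (PT x hx).2.2.2.2.2.2.2) zero_le_one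
  · rw [GS]
    exact padicNorm.sum_le' (fun x hx => (PT x hx).2.2.2.2.2.2.2) zero_le_one
  · have e : (p : ℚ) ^ 5 * WM n p b + alphaD * GS n p b =
        ∑ x ∈ MinT1 n p, ((p : ℚ) ^ 5 * (classW b p x + classW b p (41 * n - (x + 4 * p))) + alphaD * gHat b p x) +
          ∑ x ∈ MinS n p, (p : ℚ) ^ 5 * classW b p x := by
      rw [WM, mul_sum, sum_minAll hp14, GS, mul_sum, add_right_comm, ← sum_add_distrib]
      refine congrArg₂ _ (sum_congr rfl fun x _ => by ring) rfl
    rw [e]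
    refine small_add (padicNorm.sum_le' (fun x hx => (PT x hx).1) (zpow_p_nonneg _)) (small_of_two_mul hp5 ?_)
    have e2 : (2 : ℚ) * ∑ x ∈ MinS n p, (p : ℚ) ^ 5 * classW b p x =
        ∑ x ∈ MinS n p, (p : ℚ) ^ 5 * (classW b p x + classW b p (41 * n - (x + 4 * p))) := by
      rw [two_mul, sum_congr rfl fun x _ => mul_add _ _ _, sum_add_distrib,
        sum_minS_conj hp14 (fun x => (p : ℚ) ^ 5 * classW b p x)]
    rw [e2]
    exact padicNorm.sum_le' (fun x hx => (PS x hx).1) (zpow_p_nonneg _)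
  · have e : (p : ℚ) ^ 8 * VM n p b - betaD * GS n p b =
        ∑ x ∈ MinT1 n p, ((p : ℚ) ^ 8 * (classV b p x + classV b p (41 * n - (x + 4 * p))) - betaD * gHat b p x) +
          ∑ x ∈ MinS n p, (p : ℚ) ^ 8 * classV b p x := by
      rw [VM, mul_sum, sum_minAll hp14, GS, mul_sum, add_sub_right_comm, ← sum_sub_distrib]
      refine congrArg₂ _ (sum_congr rfl fun x _ => by ring) rfl
    rw [e]
    refine small_add (padicNorm.sum_le' (fun x hx => (PT x hx).2.1) (zpow_p_nonneg _)) (small_of_two_mul hp5 ?_)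
    have e2 : (2 : ℚ) * ∑ x ∈ MinS n p, (p : ℚ) ^ 8 * classV b p x =
        ∑ x ∈ MinS n p, (p : ℚ) ^ 8 * (classV b p x + classV b p (41 * n - (x + 4 * p))) := by
      rw [two_mul, sum_congr rfl fun x _ => mul_add _ _ _, sum_add_distrib,
        sum_minS_conj hp14 (fun x => (p : ℚ) ^ 8 * classV b p x)]
    rw [e2]
    exact padicNorm.sum_le' (fun x hx => (PS x hx).2.1) (zpow_p_nonneg _)

end MinBlock

/-! ### §4 The rest: `‖W_R‖ ≤ p⁴`, `‖V_R‖ ≤ p⁷` for `b(n)` and `b(n) + e₇` -/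

section Rest

variable {n : ℕ} (hn : 1 ≤ n) (hp14 : 14 * n < 2 * p) (hp15 : 2 * p < 15 * n) (hp5 : 5 ≤ p)

include hp14 hp15 in
omit hp in
/-- The class data of `b(n)` on the non-minimal classes: `E_x ≥ −7`, `ν_x ≥ −7`. -/
theorem rest_data {x : ℕ} (hx : x ∈ range p \ MinAll n p) :
    x < p ∧ (1 ≤ classPoleCount (bRec n) p x → -7 ≤ classNu (bRec n) p x) ∧
      (2 ≤ classPoleCount (bRec n) p x → -7 ≤ classExp (bRec n) p x) := by
  rw [mem_sdiff, mem_range, MinAll, mem_union, mem_union, not_or, not_or] at hx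
  obtain ⟨hxp, ⟨h1, h2⟩, h3⟩ := hx
  exact ⟨hxp, fun _ => classNu_ge_of_notMin hp14 hp15 hxp h1 h2 h3, fun _ => classExp_ge_of_notMin hp14 hp15 hxp h1 h2 h3⟩

include hp14 hp15 hp5 in
/-- **`‖W_R(b(n))‖ ≤ p⁴` and `‖V_R(b(n))‖ ≤ p⁷`.** -/
theorem rest_bRecD : padicNorm p (WR n p (bRec n)) ≤ (p : ℚ) ^ (4 : ℤ) ∧
    padicNorm p (VR n p (bRec n)) ≤ (p : ℚ) ^ (7 : ℤ) := by
  have hb := inPolytope_bRec n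
  have hwin : (bRec n 0 + 2 : ℤ) < (p : ℤ) ^ 2 := by rw [bRec_zero]; nlinarith
  refine ⟨padicNorm.sum_le' (fun x hx => ?_) (zpow_p_nonneg _), padicNorm.sum_le' (fun x hx => ?_) (zpow_p_nonneg _)⟩
  · obtain ⟨-, -, hE⟩ := rest_data hp14 hp15 hx
    have := padicNorm_classW_le (m := -7) _ hb hp5 hwin (by norm_num) hE
    norm_num at this; exact this
  · obtain ⟨hxp, hν, -⟩ := rest_data hp14 hp15 hx
    have := padicNorm_classV_le_of (v := -7) _ hb hp5 hwin hxp hν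
    norm_num at this; exact this

include hn hp14 hp15 hp5 in
/-- **`‖W_R(b(n)+e₇)‖ ≤ p⁴` and `‖V_R(b(n)+e₇)‖ ≤ p⁷`** (shift monotonicity of the class data). -/
theorem rest_shiftD : padicNorm p (WR n p (shift (bRec n) 7)) ≤ (p : ℚ) ^ (4 : ℤ) ∧
    padicNorm p (VR n p (shift (bRec n) 7)) ≤ (p : ℚ) ^ (7 : ℤ) := by
  have hb := inPolytope_bRec n
  have hb' := inPolytope_shift_bRec n 7 hn (by norm_num) (by norm_num)
  have hwin : (bRec n 0 + 2 : ℤ) < (p : ℤ) ^ 2 := by rw [bRec_zero]; nlinarith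
  have hwin' : (shift (bRec n) 7 0 + 2 : ℤ) < (p : ℤ) ^ 2 := by rw [shift_zero _ (by norm_num)]; exact hwin
  have hcnt : ∀ x, classPoleCount (shift (bRec n) 7) p x ≤ classPoleCount (bRec n) p x :=
    fun x => classPoleCount_shift_le _ hb.1 (by norm_num) p x
  refine ⟨padicNorm.sum_le' (fun x hx => ?_) (zpow_p_nonneg _), padicNorm.sum_le' (fun x hx => ?_) (zpow_p_nonneg _)⟩
  · obtain ⟨-, -, hE⟩ := rest_data hp14 hp15 hx
    have := padicNorm_classW_le (m := -7) _ hb' hp5 hwin' (by norm_num) fun h2 =>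
      (hE (h2.trans (hcnt x))).trans (classExp_shift_ge _ hb.1 (by norm_num) p x)
    norm_num at this; exact this
  · obtain ⟨hxp, hν, -⟩ := rest_data hp14 hp15 hx
    have := padicNorm_classV_le_of (v := -7) _ hb' hp5 hwin' hxp fun h1 =>
      (hν (h1.trans (hcnt x))).trans (classNu_shift_ge _ hb.1 (by norm_num) h1)
    norm_num at this; exact this

end Rest

/-! ### §5 RECORD CELL D -/

/-- `‖p^k‖·‖X‖`: if `‖X‖ ≤ p^k` then `‖p^k · X‖ ≤ 1`. -/
theorem nI_scale {X : ℚ} {k : ℕ} (h : padicNorm p X ≤ (p : ℚ) ^ (k : ℤ)) : padicNorm p ((p : ℚ) ^ k * X) ≤ 1 := by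
  rw [padicNorm.mul, padicNorm_p_pow]
  have hpos : (0 : ℚ) < (p : ℚ) ^ k := pow_pos (by exact_mod_cast hp.out.pos) k
  calc ((p : ℚ) ^ k)⁻¹ * padicNorm p X ≤ ((p : ℚ) ^ k)⁻¹ * (p : ℚ) ^ (k : ℤ) :=
        mul_le_mul_of_nonneg_left h (inv_nonneg.2 hpos.le)
    _ = 1 := by rw [zpow_natCast, inv_mul_cancel₀ hpos.ne']

/-- **RECORD CELL D (census g11) is a THEOREM.**  For `n ≥ 2` and every prime `7n < p < 7.5n`:
`v_p(W(b⁺)V(b) − W(b)V(b⁺)) ≥ −12` for `b = b(n) = n·(41;17,…,11)`, `b⁺ = b + e₇` — one more than THEOREM LB gives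
(`casLB = −13`), and the exact value at all 15 instances `n ≤ 16` of census g11.  Literally the statement `CellAtlas.RecordCellD`. -/
theorem recordCellD : ∀ n p : ℕ, 2 ≤ n → p.Prime → 14 * n < 2 * p → 2 * p < 15 * n → casoratian (bRec n) 7 ≠ 0 →
    (-12 : ℤ) ≤ padicValRat p (casoratian (bRec n) 7) := by
  intro n p hn2 hprime hp14 hp15 hne
  haveI : Fact p.Prime := ⟨hprime⟩
  have hn : 1 ≤ n := by omega
  have hp5 : 5 ≤ p := by omega
  set b := bRec n with hbdef
  set b' := shift (bRec n) 7 with hb'def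
  have hb : InPolytope b := inPolytope_bRec n
  have hb' : InPolytope b' := inPolytope_shift_bRec n 7 hn (by norm_num) (by norm_num)
  have hwin : (b 0 + 2 : ℤ) < (p : ℤ) ^ 2 := by rw [hbdef, bRec_zero]; nlinarith
  have hwin' : (b' 0 + 2 : ℤ) < (p : ℤ) ^ 2 := by rw [hb'def, shift_zero _ (by norm_num)]; exact hwin
  have hN : (b 0).toNat = 41 * n := bRec_zero_toNat n
  have hN' : (b' 0).toNat = 41 * n := shift7_zero_toNat n
  have hcen : ∀ x, x < p → 2 * x + 4 * p ≠ 41 * n → 2 * x + 5 * p ≠ 41 * n → ¬ CentreIn b p x :=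
    fun x hx h4 h5 => not_centreIn hp14 hp15 hx h4 h5
  have hcen' : ∀ x, x < p → 2 * x + 4 * p ≠ 41 * n → 2 * x + 5 * p ≠ 41 * n → ¬ CentreIn b' p x :=
    fun x hx h4 h5 h => not_centreIn hp14 hp15 hx h4 h5 ((centreIn_shift (bRec n) (by norm_num : 1 ≤ 7) p x).1 h)
  have hT1 := fun x (hx : x ∈ MinT1 n p) => (netExp_minT1 hp14 hp15 hx).1
  have hS := fun x (hx : x ∈ MinS n p) => (netExp_minS hp14 hp15 hx).1
  have hT2 := fun x (hx : x ∈ MinT2 n p) => (netExp_minT2 hp14 hp15 hx).1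
  have hT1' := fun x (hx : x ∈ MinT1 n p) => (netExp_minT1 hp14 hp15 hx).2.1
  have hS' := fun x (hx : x ∈ MinS n p) => (netExp_minS hp14 hp15 hx).2.1
  have hT2' := fun x (hx : x ∈ MinT2 n p) => (netExp_minT2 hp14 hp15 hx).2.1
  -- the bounded quantities
  set A := (p : ℚ) ^ 5 * WM n p b with hAdef
  set A' := (p : ℚ) ^ 5 * WM n p b' with hA'def
  set B := (p : ℚ) ^ 8 * VM n p b with hBdef
  set B' := (p : ℚ) ^ 8 * VM n p b' with hB'def
  set G := GS n p b with hGdef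
  set G' := GS n p b' with hG'def
  set C := (p : ℚ) ^ 7 * VR n p b with hCdef
  set C' := (p : ℚ) ^ 7 * VR n p b' with hC'def
  set R := (p : ℚ) ^ 4 * WR n p b with hRdef
  set R' := (p : ℚ) ^ 4 * WR n p b' with hR'def
  obtain ⟨iA, iB, iαG, iG, cA, cB⟩ := minBlock hp14 hp15 hp5 b hb hwin hN hcen hT1 hS hT2
  obtain ⟨iA', iB', iαG', iG', cA', cB'⟩ := minBlock hp14 hp15 hp5 b' hb' hwin' hN' hcen' hT1' hS' hT2'
  obtain ⟨iWR, iVR⟩ := rest_bRecD (p := p) hp14 hp15 hp5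
  obtain ⟨iWR', iVR'⟩ := rest_shiftD (p := p) hn hp14 hp15 hp5
  have iR : padicNorm p R ≤ 1 := nI_scale iWR
  have iR' : padicNorm p R' ≤ 1 := nI_scale iWR'
  have iC : padicNorm p C ≤ 1 := nI_scale iVR
  have iC' : padicNorm p C' ≤ 1 := nI_scale iVR'
  -- the key congruence `A′B ≡ AB′`
  have key : padicNorm p (A' * B - A * B') ≤ (p : ℚ) ^ (-(1 : ℤ)) := by
    have e : A' * B - A * B' =
        (A' + alphaD * G') * B - alphaD * G' * (B - betaD * G) - (A + alphaD * G) * B' + alphaD * G * (B' - betaD * G') := by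
      ring
    rw [e]
    exact small_add (small_sub (small_sub (by rw [mul_comm]; exact small_mul iB cA') (small_mul iαG' cB))
      (by rw [mul_comm]; exact small_mul iB' cA)) (small_mul iαG cB')
  -- the identity
  have hp0 : (p : ℚ) ≠ 0 := Nat.cast_ne_zero.2 hprime.ne_zero
  have hW : coeffW b = A / (p : ℚ) ^ 5 + R / (p : ℚ) ^ 4 := by
    rw [coeffW_split n hprime.pos b, hAdef, hRdef]; field_simp
  have hW' : coeffW b' = A' / (p : ℚ) ^ 5 + R' / (p : ℚ) ^ 4 := by
    rw [coeffW_split n hprime.pos b', hA'def, hR'def]; field_simp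
  have hV : coeffV b = B / (p : ℚ) ^ 8 + C / (p : ℚ) ^ 7 := by
    rw [coeffV_split n hprime.pos b, hBdef, hCdef]; field_simp
  have hV' : coeffV b' = B' / (p : ℚ) ^ 8 + C' / (p : ℚ) ^ 7 := by
    rw [coeffV_split n hprime.pos b', hB'def, hC'def]; field_simp
  have e : (p : ℚ) ^ 13 * casoratian b 7 =
      (A' * B - A * B') + p * (A' * C + R' * B - A * C' - R * B') + (p : ℚ) ^ 2 * (R' * C - R * C') := by
    rw [casoratian, ← hb'def, hW, hW', hV, hV']
    field_simp
    ring
  -- the bound `‖p¹³·Cas‖ ≤ p⁻¹`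
  have ip : padicNorm p (p : ℚ) ≤ 1 := nI_nat p
  have h13 : padicNorm p ((p : ℚ) ^ 13 * casoratian b 7) ≤ (p : ℚ) ^ (-(1 : ℤ)) := by
    rw [e]
    refine small_add (small_add key (small_p_mul ?_)) ?_
    · exact nI_sub (nI_sub (nI_add (padicNorm_mul_le_one iA' iC) (padicNorm_mul_le_one iR' iB))
        (padicNorm_mul_le_one iA iC')) (padicNorm_mul_le_one iR iB')
    · rw [pow_two, mul_assoc]
      exact small_mul ip (small_p_mul (nI_sub (padicNorm_mul_le_one iR' iC) (padicNorm_mul_le_one iR iC')))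
  -- unscale
  apply val_ge_of_padicNorm_le hne
  have hp13n : padicNorm p ((p : ℚ) ^ 13) = ((p : ℚ) ^ 13)⁻¹ := padicNorm_p_pow 13
  have hpos : (0 : ℚ) < (p : ℚ) ^ 13 := pow_pos (by exact_mod_cast hprime.pos) 13
  rw [padicNorm.mul, hp13n, inv_mul_le_iff₀ hpos] at h13
  refine h13.trans (le_of_eq ?_)
  rw [neg_neg, ← zpow_natCast, ← zpow_add₀ hp0]
  norm_num

/-- **`CellAtlas.RecordCellD` (census g11) is a THEOREM** — discharged by name. -/
theorem recordCellD_holds : CellAtlas.RecordCellD := recordCellD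

end Summit.KontsevichZagierPeriods.Zeta5Search.CellD

end
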